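import Mathlib

/-!
# Dimock, *The renormalization group according to Balaban* I, §4.7 "scaling" – §4.8 "completion of the proof": the
# assembly (stanley8) → (stanley9) that closes the induction of THEOREM 14 (`\label{lanky}`) — the recursion
# (recursive) `(ε_k, μ_k, λ_k, E_k) ↦ (ε_{k+1}, μ_{k+1}, λ_{k+1}, E_{k+1})` as DEFINITIONS read off the two extractions
# (renorm2), the exponent identity, the six bounds of THEOREM 14 from the shapes (bb1), (bb2), Lemmas `rlem`∕`study`,
# and the `κ`-arithmetic of L2576–2577 — PROVED (bookkeeping; Mathlib only)

**Citation header (reproduction of PUBLISHED work; template of the Bałaban lattice Yang–Mills cell).**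
J. Dimock, *The renormalization group according to Balaban I. Small fields*, Rev. Math. Phys. **25** (2013) 1330010
(= arXiv:1108.1335v2) [Dimock2013]: §4.1 THEOREM `\label{lanky}` (= THEOREM 14 of the shared counter
`\newtheorem{thm}{Theorem}`, `\newtheorem{lem}[thm]{Lemma}`) TeX L1924–1952 with the recursion (recursive) L1932–1939 and
the bounds L1941–1951; §3.5 "normalization": the extraction identity (renorm2) L1802–1815 and LEMMA `\label{study}` (#13)
L1824–1836, LEMMA `\label{rlem}` (#12) L1759–1763; §4.7 "scaling" L2542–2597 ((bb1) L2558–2560, the `κ`-condition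
L2576–2577, (bb2) L2579–2582, (stanley8) L2589–2597); §4.8 "completion of the proof" L2604–2670 (the 𝓛_i L2617–2630,
the starred quantities L2639–2655, (stanley9) L2660–2670).  TeX line numbers refer to the arXiv source held by the cell
(`inputs/files/dimock/src/1108.1335/1108.1335.tex`); every quotation below was read there this session.  Dimock's
papers are published and refereed and are the cell's TEMPLATE, not manuscripts under audit; no quantity of the
Bałaban series is touched.

**What the paper prints (verbatim).**  (stanley8), L2588–2597: *"Altogether then ρ_{k+1}(Φ_{k+1}) = Z_{k+1} exp(
−S_{k+1}(Φ_{k+1}, φ_{k+1}) − L³(ε_k + ε_k^0)Vol(𝕋_{M+N−k−1}) − ½L²μ_k‖φ_{k+1}‖² − ¼λ_{k+1}∫φ_{k+1}⁴ +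
(ℬE_k)_{L^{−1}}(φ_{k+1}) + E^#_{k,L^{−1}}(φ_{k+1}))"*.  §4.8, L2606–2611: *"Neither (ℬE_k)_{L^{−1}} nor E^#_{k,L^{−1}}
are normalized for small polymers, and we need this feature to complete the induction. … We remove energy and mass
terms to normalize them."*  L2616–2635: *"By (renorm2) (ℬE_k)_{L^{−1}}(φ_{k+1}) = −𝓛₁E_k Vol(𝕋_{N+M−k−1}) − ½𝓛₂E_k
‖φ²_{k+1}‖ + (𝓛₃E_k)(φ_{k+1}) where 𝓛₁E_k = ε((ℬE_k)_{L^{−1}}), 𝓛₂E_k = μ((ℬE_k)_{L^{−1}}), 𝓛₃E_k = 𝓡((ℬE_k)_{L^{−1}})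
From the bound (bb1) and lemma rlem and lemma study we have that |𝓛₁E_k| and ‖𝓛₃E_k‖_{k+1,κ} are bounded by
𝒪(L^{−ε})‖E_k‖_{k,κ} and that |𝓛₂E_k| is bounded by 𝒪(L^{−ε})λ_k^{1/2+6ε}‖E_k‖_{k,κ}. These are the required
bounds"*.  L2637–2655: *"We also apply (renorm2) to E^#_{k,L^{−1}} but now tack on the extra term ε_k^0  We have
E^#_{k,L^{−1}}(φ_{k+1}) − L³ε_k^0 Vol(𝕋_{N+M−k−1}) = −ε_k^* Vol(𝕋_{N+M−k−1}) − ½μ_k^*‖φ²_{k+1}‖ + E_k^*(φ_{k+1}) where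
ε_k^* = L³ε_k^0 + ε(E^#_{k,L^{−1}}), μ_k^* = μ(E^#_{k,L^{−1}}), E_k^* = 𝓡(E^#_{k,L^{−1}})  From the bound (bb2) and
lemma rlem and lemma study, |ε_k^*| and ‖E_k^*‖_{k+1,κ} are bounded by 𝒪(1)L³λ_k^{1/4−10ε} and |μ_k^*| is bounded by
𝒪(1)L³λ_k^{3/4−4ε}. These are the required bounds."*  L2659–2670: *"Insert these expansions into (stanley8) and obtain
the final form ρ_{k+1}(Φ_{k+1}) = Z_{k+1} exp(−S_{k+1}(Φ_{k+1}, φ_{k+1}) − ε_{k+1}Vol(𝕋_{M+N−k−1}) − ½μ_{k+1}‖φ_{k+1}‖²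
− ¼λ_{k+1}∫φ_{k+1}⁴ + E_{k+1}(φ_{k+1})) where ε_{k+1}, μ_{k+1}, E_{k+1} are given by (recursive). This completes the
proof of theorem lanky."*  (recursive), L1932–1939: *"ε_{k+1} = L³ε_k + 𝓛₁E_k + ε_k^*(λ_k, μ_k, E_k),  μ_{k+1} = L²μ_k +
𝓛₂E_k + μ_k^*(λ_k, μ_k, E_k),  λ_{k+1} = Lλ_k,  E_{k+1} = 𝓛₃E_k + E^*_k(λ_k, μ_k, E_k)"*.  The `κ`-condition, L2570–2582:
*"For φ ∈ 𝓡_{k+1} we have φ_L ∈ ½𝓡_k and so by (osprey) |E^#_{k,L^{−1}}(X, φ)| ≤ 𝒪(1)L³λ_k^{1/4−10ε}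
e^{−L(κ−5κ₀−5)d_{LM}(X)}  We need L(κ − 5κ₀ − 5) ≥ κ or equivalently κ ≥ 5L(L−1)^{−1}(κ₀+1). Since L ≥ 2 it suffices
that κ ≥ 10(κ₀+1) which we assume. Then ‖E^#_{k,L^{−1}}‖_{k+1,κ} ≤ 𝒪(1)L³λ_k^{1/4−10ε}"* (bb2).

**What is reproduced here (kernel-checked, zero `sorry`; Mathlib only).**  The two §§ are BOOKKEEPING once the
analytic inputs are granted, and this module kernel-checks exactly that bookkeeping over an abstract space `Φ` of
fields (print: `φ_{k+1} ∈ 𝓡_{k+1}`), an abstract "volume" `V` (print: `Vol(𝕋_{M+N−k−1})`) and an abstract square-norm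
functional `nsq φ` (print: `‖φ_{k+1}‖²`):
* §1 the EXTRACTION SHAPE `Extracted V nsq` — a functional `F : Φ → ℝ` together with numbers `ε(F)`, `μ(F)` and a
  remainder `𝓡F` satisfying (renorm2) *"F = −ε(F)Vol(𝕋) − ½μ(F)‖φ‖² + 𝓡F"* (hypothesis shape; its derivation for
  polymer activities is §3.5 (renorm), not asserted here), plus the two norms `‖F‖_{k+1,κ}`, `‖𝓡F‖_{k+1,κ}` as numbers;
* §2 the DEFINITIONS (recursive)∕L2623–2630∕L2646–2651: `L1E`, `L2E`, `L3E` (the relevant and irrelevant parts of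
  `(ℬE_k)_{L^{−1}}`), `epsStar`, `muStar`, `EStar` (those of `E^#_{k,L^{−1}}` with `L³ε_k^0` *"tacked on"*), `epsNext`,
  `muNext`, `ENext`; the two displayed partial identities L2617–2621 (`reblocked_eq`) and L2639–2644 (`sharp_eq`); and
  **`stanley9_of_stanley8`** — the exponent of (stanley8) EQUALS the exponent of (stanley9) with these definitions
  (`ring` after the two extraction identities) — *"This completes the proof of theorem lanky"*;
* §3 the SIX BOUNDS of THEOREM 14 from the shapes: `StudyBounds` (= LEMMAS rlem + study for one extracted functional:
  `|ε(F)| ≤ c‖F‖`, `|μ(F)| ≤ c·s·‖F‖`, `‖𝓡F‖ ≤ c‖F‖`, with the small factor `s` — print: `λ^{1/2+6ε}` — kept as a named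
  real), (bb1) `‖(ℬE_k)_{L^{−1}}‖_{k+1,κ} ≤ c_B L^{−ε}‖E_k‖_{k,κ}`, (bb2) `‖E^#_{k,L^{−1}}‖_{k+1,κ} ≤ C L³λ_k^{1/4−10ε}` and the
  vacuum-energy input `|ε_k^0| ≤ c₀λ_k^{1/4−10ε}` (print, §4.4: `ε_k^0 ≤ 𝒪(e^{−p²_{0,k}/2})`): **`L1E_le`**, **`L2E_le`**,
  **`L3E_le`** (`𝒪(L^{−ε})‖E_k‖`, resp. `× s`), **`epsStar_le`** (`(c₀ + cC)L³λ^{1/4−10ε}`), **`muStar_le`** (`cC·s·L³λ^{1/4−10ε}`),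
  **`EStar_le`** (`cC L³λ^{1/4−10ε}`), and **`muStar_le_rpow`** — with `s = λ^{1/2+6ε}` the printed `𝒪(1)L³λ_k^{3/4−4ε}`
  (`λ^{1/2+6ε}·λ^{1/4−10ε} = λ^{3/4−4ε}`); every `𝒪(1)` an explicit product of the input constants;
* §4 the `κ`-ARITHMETIC: **`kappa_condition_iff`** (`L(κ − 5κ₀ − 5) ≥ κ ⟺ κ ≥ 5L(L−1)^{−1}(κ₀+1)` for `L > 1`),
  **`kappa_condition_of_ten`** (`L ≥ 2`, `κ₀ + 1 ≥ 0`, `κ ≥ 10(κ₀+1) ⟹ L(κ − 5κ₀ − 5) ≥ κ`), and the pointwise-to-norm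
  step (bb2) as a finite weighted supremum: **`weightedSup_le_of_pointwise`** (`|G(X)| ≤ A e^{−κ′d(X)}` for all `X`,
  `κ ≤ κ′`, `d ≥ 0` ⟹ `sup_X |G(X)|e^{κ d(X)} ≤ A`);
* §5 the SCALING of the potential, L2551–2555: **`V_scaled`** — from the three scaling rules `Vol(𝕋_{M+N−k}) =
  L³Vol(𝕋_{M+N−k−1})`, `‖φ_{k+1,L}‖² = L²‖φ_{k+1}‖²`, `∫φ_{k+1,L}⁴ = L∫φ_{k+1}⁴` (hypotheses; the lattice change of
  variables is §2.3's scaling lemma, kernel elsewhere in this directory) the printed *"V_k(φ_{k+1,L}) = L³ε_kVol(𝕋_{M+N−k−1})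
  + ½L²μ_k‖φ_{k+1}‖² + ¼Lλ_k∫φ_{k+1}⁴"*.

**Readings ∕ divergences (declared).**  (i) ABSTRACT FUNCTIONALS: `(ℬE_k)_{L^{−1}}` and `E^#_{k,L^{−1}}` are any two
functionals carrying the extraction shape; the norms `‖·‖_{k,κ}`, `‖·‖_{k+1,κ}` enter as nonnegative reals attached to
them; the maps `E_k ↦ 𝓛_iE_k` are therefore not typed as (linear) operators here — their linearity (L1940 *"where the
𝓛_i are linear operators"*) is the linearity of `ℬ`, of scaling and of `ε(·)`, `μ(·)`, `𝓡(·)`, which belongs to §3.4–3.5.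
(ii) THE SMALL FACTOR `s`: LEMMA study prints `|μ(E)| ≤ 𝒪(1)λ_k^{1/2+6ε}‖E‖_{k,κ}` for `E ∈ 𝒦_k`; in §4.8 it is applied
to elements of `𝒦_{k+1}` and the outcome is printed with `λ_k^{1/2+6ε}` (L2634) resp. `λ_k^{3/4−4ε}` (L2655); the module
keeps the factor as a named real `s ≥ 0` and offers the printed exponent arithmetic for `s = λ_k^{1/2+6ε}`
(`muStar_le_rpow`) — which level's `λ` the `𝒪(1)` absorbs (`λ_{k+1} = Lλ_k`) is not adjudicated (records only).
(iii) CONSTANTS: `𝒪(L^{−ε})` and `𝒪(1)L³` are explicit products `c·c_B·L^{−ε}`, `(c₀ + cC)L³`, `cC·L³` of the input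
constants.  (iv) The identity (stanley9) is an identity of EXPONENTS, pointwise in `φ_{k+1}` (the common factor
`Z_{k+1} exp(·)` and the term `−S_{k+1}` are carried along unchanged); `λ_{k+1} = Lλ_k` is notation (`lamNext`).

**What is NOT claimed.**  The analytic inputs — (bb1) = LEMMA scalinglem, (bb2) = (osprey) + the reblocking of `E^#`,
LEMMAS rlem∕study, the fluctuation-integral outputs `E_k^#`, `ε_k^0` of §§4.2–4.6 — are hypothesis shapes, not
asserted; the representation (basic)–(basic3) of `ρ_k` and the measure-theoretic content of THEOREM 14 are not typed;
nothing of B1–B16 is touched (TEMPLATE.md §4.1 row «D1 §4.7–4.8» ↔ B12 (0.18)–(0.23): the β-function step and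
re-labelling — grade P there, a different (marginal) mechanism; untouched).  NOT summit progress; NOT a statement about
any Bałaban paper; NOT continuum; NOT Clay.  NEW leaf; imports Mathlib only; sub-namespace
`…Dimock2011to13.SmallFieldStepAssembly`; modifies nothing.  Unit `b2b-balaban-template` gen 32 (journal CLAIM
D1-STEP-ASSEMBLY-KERNEL); cell records TEMPLATE.md §4.1 row «D1 §4.7–4.8», §15.2; GAPS C-tmpl32-1.  The flow built on
(recursive) is `…Dimock2011to13.SmallFieldFlow` (THEOREM 24, kernel) — by name only, not imported.
-/

noncomputable section

open Real Finset

namespace Literature.MathematicalPhysics.QuantumFieldTheory.Dimock2011to13.SmallFieldStepAssembly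

variable {Φ : Type*}

/-! ## §1 The extraction shape (renorm2) -/

/-- **THE EXTRACTION SHAPE (renorm2)** for one functional of the level-`k+1` fields: a functional `F` (print:
`(ℬE_k)_{L^{−1}}` or `E^#_{k,L^{−1}}`, summed over polymers), its norm `nF = ‖F‖_{k+1,κ}`, the extracted vacuum energy
`eps = ε(F)` and mass `mu = μ(F)`, the remainder `R = 𝓡F` with its norm `nR = ‖𝓡F‖_{k+1,κ}`, and the identity,
verbatim (L1804–1807): *"E = −ε(E)Vol(𝕋_{M+N−k}) − ½μ(E)‖φ‖² + 𝓡E"* — here with the abstract volume `V` and square norm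
`nsq`.  HYPOTHESIS SHAPE: the derivation of (renorm2) from (renorm) (§3.5 L1730–1821) is not asserted here.
[cite: Dimock2013, §3.5 eq. (renorm2) (arXiv:1108.1335v2 TeX L1802–1815)] -/
structure Extracted (V : ℝ) (nsq : Φ → ℝ) where
  /-- the functional `F(φ)` -/
  F : Φ → ℝ
  /-- its norm `‖F‖_{k+1,κ}` -/
  nF : ℝ
  /-- `ε(F)` -/
  eps : ℝ
  /-- `μ(F)` -/
  mu : ℝ
  /-- `𝓡F` -/
  R : Φ → ℝ
  /-- `‖𝓡F‖_{k+1,κ}` -/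
  nR : ℝ
  /-- norms are nonnegative -/
  nF_nonneg : 0 ≤ nF
  /-- (renorm2): `F(φ) = −ε(F)·V − ½μ(F)‖φ‖² + 𝓡F(φ)` -/
  eq : ∀ φ, F φ = -eps * V - (1 / 2) * mu * nsq φ + R φ

variable {V : ℝ} {nsq : Φ → ℝ}

/-! ## §2 The recursion (recursive) as definitions, and the identity (stanley8) = (stanley9) -/

/-- `𝓛₁E_k = ε((ℬE_k)_{L^{−1}})` (L2625). [cite: Dimock2013, §4.8 (arXiv:1108.1335v2 TeX L2623–2630)] -/
def L1E (XB : Extracted V nsq) : ℝ := XB.eps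

/-- `𝓛₂E_k = μ((ℬE_k)_{L^{−1}})` (L2627). [cite: Dimock2013, §4.8 (arXiv:1108.1335v2 TeX L2623–2630)] -/
def L2E (XB : Extracted V nsq) : ℝ := XB.mu

/-- `𝓛₃E_k = 𝓡((ℬE_k)_{L^{−1}})` (L2628). [cite: Dimock2013, §4.8 (arXiv:1108.1335v2 TeX L2623–2630)] -/
def L3E (XB : Extracted V nsq) : Φ → ℝ := XB.R

/-- `ε_k^* = L³ε_k^0 + ε(E^#_{k,L^{−1}})` (L2648) — the vacuum energy of the fluctuation integral *"tacked on"*.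
[cite: Dimock2013, §4.8 (arXiv:1108.1335v2 TeX L2637–2651)] -/
def epsStar (Lr eps0 : ℝ) (XS : Extracted V nsq) : ℝ := Lr ^ 3 * eps0 + XS.eps

/-- `μ_k^* = μ(E^#_{k,L^{−1}})` (L2649). [cite: Dimock2013, §4.8 (arXiv:1108.1335v2 TeX L2646–2651)] -/
def muStar (XS : Extracted V nsq) : ℝ := XS.mu

/-- `E_k^* = 𝓡(E^#_{k,L^{−1}})` (L2650). [cite: Dimock2013, §4.8 (arXiv:1108.1335v2 TeX L2646–2651)] -/
def EStar (XS : Extracted V nsq) : Φ → ℝ := XS.R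

/-- `ε_{k+1} = L³ε_k + 𝓛₁E_k + ε_k^*` — first line of (recursive). [cite: Dimock2013, Theorem lanky eq. (recursive)
(arXiv:1108.1335v2 TeX L1932–1939)] -/
def epsNext (Lr epsk eps0 : ℝ) (XB XS : Extracted V nsq) : ℝ := Lr ^ 3 * epsk + L1E XB + epsStar Lr eps0 XS

/-- `μ_{k+1} = L²μ_k + 𝓛₂E_k + μ_k^*` — second line of (recursive). [cite: Dimock2013, Theorem lanky eq. (recursive)
(arXiv:1108.1335v2 TeX L1932–1939)] -/
def muNext (Lr muk : ℝ) (XB XS : Extracted V nsq) : ℝ := Lr ^ 2 * muk + L2E XB + muStar XS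

/-- `λ_{k+1} = Lλ_k` — third line of (recursive) (*"We continue to treat λ_k as a parameter"*, L2747).
[cite: Dimock2013, Theorem lanky eq. (recursive) (arXiv:1108.1335v2 TeX L1932–1939)] -/
def lamNext (Lr lamk : ℝ) : ℝ := Lr * lamk

/-- `E_{k+1} = 𝓛₃E_k + E_k^*` — fourth line of (recursive). [cite: Dimock2013, Theorem lanky eq. (recursive)
(arXiv:1108.1335v2 TeX L1932–1939)] -/
def ENext (XB XS : Extracted V nsq) : Φ → ℝ := fun φ => L3E XB φ + EStar XS φ

/-- `λ_{k+1} = Lλ_k`, unfolded. [cite: Dimock2013, Theorem lanky eq. (recursive) (arXiv:1108.1335v2 TeX L1936)] -/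
@[simp] theorem lamNext_def (Lr lamk : ℝ) : lamNext Lr lamk = Lr * lamk := rfl

/-- L2617–2621, verbatim: *"(ℬE_k)_{L^{−1}}(φ_{k+1}) = −𝓛₁E_k Vol(𝕋_{N+M−k−1}) − ½𝓛₂E_k‖φ²_{k+1}‖ + (𝓛₃E_k)(φ_{k+1})"*.
[cite: Dimock2013, §4.8 (arXiv:1108.1335v2 TeX L2616–2630)] -/
theorem reblocked_eq (XB : Extracted V nsq) (φ : Φ) :
    XB.F φ = -L1E XB * V - (1 / 2) * L2E XB * nsq φ + L3E XB φ := XB.eq φ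

/-- L2639–2644, verbatim: *"E^#_{k,L^{−1}}(φ_{k+1}) − L³ε_k^0 Vol(𝕋_{N+M−k−1}) = −ε_k^* Vol(𝕋_{N+M−k−1}) − ½μ_k^*‖φ²_{k+1}‖
+ E_k^*(φ_{k+1})"*. [cite: Dimock2013, §4.8 (arXiv:1108.1335v2 TeX L2637–2651)] -/
theorem sharp_eq (Lr eps0 : ℝ) (XS : Extracted V nsq) (φ : Φ) :
    XS.F φ - Lr ^ 3 * eps0 * V = -epsStar Lr eps0 XS * V - (1 / 2) * muStar XS * nsq φ + EStar XS φ := by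
  rw [XS.eq φ]; simp only [epsStar, muStar, EStar]; ring

/-- THE EXPONENT OF (stanley8), L2589–2597: *"−S_{k+1}(Φ_{k+1}, φ_{k+1}) − L³(ε_k + ε_k^0)Vol(𝕋_{M+N−k−1}) − ½L²μ_k
‖φ_{k+1}‖² − ¼λ_{k+1}∫φ_{k+1}⁴ + (ℬE_k)_{L^{−1}}(φ_{k+1}) + E^#_{k,L^{−1}}(φ_{k+1})"* (`S` = the value of `S_{k+1}`,
`quart φ` = `∫φ⁴`). [cite: Dimock2013, §4.7 eq. (stanley8) (arXiv:1108.1335v2 TeX L2588–2597)] -/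
def exponent8 (S Lr epsk eps0 muk lamk : ℝ) (quart : Φ → ℝ) (XB XS : Extracted V nsq) (φ : Φ) : ℝ :=
  -S - Lr ^ 3 * (epsk + eps0) * V - (1 / 2) * (Lr ^ 2 * muk) * nsq φ - (1 / 4) * lamNext Lr lamk * quart φ
    + XB.F φ + XS.F φ

/-- THE EXPONENT OF (stanley9), L2660–2668: *"−S_{k+1}(Φ_{k+1}, φ_{k+1}) − ε_{k+1}Vol(𝕋_{M+N−k−1}) − ½μ_{k+1}‖φ_{k+1}‖²
− ¼λ_{k+1}∫φ_{k+1}⁴ + E_{k+1}(φ_{k+1})"*. [cite: Dimock2013, §4.8 eq. (stanley9) (arXiv:1108.1335v2 TeX L2659–2670)] -/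
def exponent9 (S Lr epsk eps0 muk lamk : ℝ) (quart : Φ → ℝ) (XB XS : Extracted V nsq) (φ : Φ) : ℝ :=
  -S - epsNext Lr epsk eps0 XB XS * V - (1 / 2) * muNext Lr muk XB XS * nsq φ
    - (1 / 4) * lamNext Lr lamk * quart φ + ENext XB XS φ

/-- **(stanley8) = (stanley9)** — *"Insert these expansions into (stanley8) and obtain the final form … where
ε_{k+1}, μ_{k+1}, E_{k+1} are given by (recursive). This completes the proof of theorem lanky"* (L2659–2670): with
the definitions (recursive) read off the two extractions, the two exponents agree for every field.
[cite: Dimock2013, §4.8 (arXiv:1108.1335v2 TeX L2659–2670) and Theorem lanky eq. (recursive) (TeX L1932–1939)] -/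
theorem stanley9_of_stanley8 (S Lr epsk eps0 muk lamk : ℝ) (quart : Φ → ℝ) (XB XS : Extracted V nsq) (φ : Φ) :
    exponent8 S Lr epsk eps0 muk lamk quart XB XS φ = exponent9 S Lr epsk eps0 muk lamk quart XB XS φ := by
  simp only [exponent8, exponent9, epsNext, muNext, ENext, L1E, L2E, L3E, epsStar, muStar, EStar, XB.eq φ, XS.eq φ]
  ring

/-- The same identity for the densities: `Z_{k+1} exp(exponent8) = Z_{k+1} exp(exponent9)`.
[cite: Dimock2013, §4.8 eqs. (stanley8), (stanley9) (arXiv:1108.1335v2 TeX L2588–2670)] -/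
theorem density_eq (Z S Lr epsk eps0 muk lamk : ℝ) (quart : Φ → ℝ) (XB XS : Extracted V nsq) (φ : Φ) :
    Z * exp (exponent8 S Lr epsk eps0 muk lamk quart XB XS φ) =
      Z * exp (exponent9 S Lr epsk eps0 muk lamk quart XB XS φ) := by
  rw [stanley9_of_stanley8]

/-! ## §3 The six bounds of THEOREM 14 from the shapes -/

/-- **LEMMAS rlem + study for one extracted functional, as a shape**: LEMMA study (L1824–1831), verbatim: *"|ε(E)| ≤
𝒪(1)‖E‖_{k,κ}, |μ(E)| ≤ 𝒪(1)λ_k^{1/2+6ε}‖E‖_{k,κ}"*; LEMMA rlem (L1759–1763): *"‖𝓡E(X)‖_k ≤ 𝒪(1)‖E(X)‖_k"* (whence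
`‖𝓡E‖_{k,κ} ≤ 𝒪(1)‖E‖_{k,κ}`).  TYPED with one constant `c` for the three `𝒪(1)` and the small factor `s` (print:
`λ^{1/2+6ε}`, reading (ii) of the header).  HYPOTHESIS SHAPE, not asserted. [cite: Dimock2013, §3.5 Lemmas rlem, study
(arXiv:1108.1335v2 TeX L1759–1763, L1824–1836)] -/
structure StudyBounds (X : Extracted V nsq) (c s : ℝ) : Prop where
  /-- `|ε(F)| ≤ c‖F‖` -/
  eps_le : |X.eps| ≤ c * X.nF
  /-- `|μ(F)| ≤ c·s·‖F‖` -/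
  mu_le : |X.mu| ≤ c * s * X.nF
  /-- `‖𝓡F‖ ≤ c‖F‖` -/
  R_le : X.nR ≤ c * X.nF

section bounds

variable {XB XS : Extracted V nsq} {c s cB CS c0 Lr lamk ε eps0 nE : ℝ}

/-- **THEOREM 14, `|𝓛₁E_k| ≤ 𝒪(1)L^{−ε}‖E_k‖_{k,κ}`** from (bb1) `‖(ℬE_k)_{L^{−1}}‖_{k+1,κ} ≤ c_B L^{−ε}‖E_k‖_{k,κ}` and LEMMA
study (L2631–2635). [cite: Dimock2013, Theorem lanky (arXiv:1108.1335v2 TeX L1941–1947) and §4.8 L2631–2635] -/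
theorem L1E_le (hS : StudyBounds XB c s) (hc : 0 ≤ c) (hbb1 : XB.nF ≤ cB * Lr ^ (-ε) * nE) :
    |L1E XB| ≤ c * cB * Lr ^ (-ε) * nE := by
  have h := hS.eps_le
  calc |L1E XB| = |XB.eps| := rfl
    _ ≤ c * XB.nF := h
    _ ≤ c * (cB * Lr ^ (-ε) * nE) := mul_le_mul_of_nonneg_left hbb1 hc
    _ = c * cB * Lr ^ (-ε) * nE := by ring

/-- **THEOREM 14, `|𝓛₂E_k| ≤ 𝒪(1)L^{−ε}λ^{1/2+6ε}‖E_k‖_{k,κ}`** (the small factor kept as `s`) from (bb1) and LEMMA study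
(L2634). [cite: Dimock2013, Theorem lanky (arXiv:1108.1335v2 TeX L1941–1947) and §4.8 L2631–2635] -/
theorem L2E_le (hS : StudyBounds XB c s) (hc : 0 ≤ c) (hs : 0 ≤ s) (hbb1 : XB.nF ≤ cB * Lr ^ (-ε) * nE) :
    |L2E XB| ≤ c * s * cB * Lr ^ (-ε) * nE := by
  have h := hS.mu_le
  calc |L2E XB| = |XB.mu| := rfl
    _ ≤ c * s * XB.nF := h
    _ ≤ c * s * (cB * Lr ^ (-ε) * nE) := mul_le_mul_of_nonneg_left hbb1 (mul_nonneg hc hs)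
    _ = c * s * cB * Lr ^ (-ε) * nE := by ring

/-- **THEOREM 14, `‖𝓛₃E_k‖_{k+1,κ} ≤ 𝒪(1)L^{−ε}‖E_k‖_{k,κ}`** from (bb1) and LEMMA rlem (L2631–2635).
[cite: Dimock2013, Theorem lanky (arXiv:1108.1335v2 TeX L1941–1947) and §4.8 L2631–2635] -/
theorem L3E_le (hS : StudyBounds XB c s) (hc : 0 ≤ c) (hbb1 : XB.nF ≤ cB * Lr ^ (-ε) * nE) :
    XB.nR ≤ c * cB * Lr ^ (-ε) * nE := by
  calc XB.nR ≤ c * XB.nF := hS.R_le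
    _ ≤ c * (cB * Lr ^ (-ε) * nE) := mul_le_mul_of_nonneg_left hbb1 hc
    _ = c * cB * Lr ^ (-ε) * nE := by ring

/-- **THEOREM 14, `|ε_k^*| ≤ 𝒪(1)L³λ_k^{1/4−10ε}`** from (bb2) `‖E^#_{k,L^{−1}}‖_{k+1,κ} ≤ C L³λ_k^{1/4−10ε}`, LEMMA study and
the vacuum energy of the fluctuation measure `|ε_k^0| ≤ c₀λ_k^{1/4−10ε}` (§4.4: `ε_k^0 ≤ 𝒪(e^{−p²_{0,k}/2})`); the `𝒪(1)`
is `c₀ + cC` (L2653–2655). [cite: Dimock2013, Theorem lanky (arXiv:1108.1335v2 TeX L1948–1951) and §4.8 L2646–2655] -/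
theorem epsStar_le (hS : StudyBounds XS c s) (hc : 0 ≤ c) (hL : 0 ≤ Lr)
    (hbb2 : XS.nF ≤ CS * Lr ^ 3 * lamk ^ (1 / 4 - 10 * ε))
    (h0 : |eps0| ≤ c0 * lamk ^ (1 / 4 - 10 * ε)) :
    |epsStar Lr eps0 XS| ≤ (c0 + c * CS) * Lr ^ 3 * lamk ^ (1 / 4 - 10 * ε) := by
  have h1 : |Lr ^ 3 * eps0| ≤ Lr ^ 3 * (c0 * lamk ^ (1 / 4 - 10 * ε)) := by
    rw [abs_mul, abs_of_nonneg (pow_nonneg hL 3)]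
    exact mul_le_mul_of_nonneg_left h0 (pow_nonneg hL 3)
  have h2 : |XS.eps| ≤ c * (CS * Lr ^ 3 * lamk ^ (1 / 4 - 10 * ε)) :=
    hS.eps_le.trans (mul_le_mul_of_nonneg_left hbb2 hc)
  calc |epsStar Lr eps0 XS| = |Lr ^ 3 * eps0 + XS.eps| := rfl
    _ ≤ |Lr ^ 3 * eps0| + |XS.eps| := abs_add_le _ _
    _ ≤ Lr ^ 3 * (c0 * lamk ^ (1 / 4 - 10 * ε)) + c * (CS * Lr ^ 3 * lamk ^ (1 / 4 - 10 * ε)) := add_le_add h1 h2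
    _ = (c0 + c * CS) * Lr ^ 3 * lamk ^ (1 / 4 - 10 * ε) := by ring

/-- **THEOREM 14, `|μ_k^*| ≤ 𝒪(1)L³·s·λ_k^{1/4−10ε}`** (small factor kept) from (bb2) and LEMMA study (L2653–2655).
[cite: Dimock2013, Theorem lanky (arXiv:1108.1335v2 TeX L1948–1951) and §4.8 L2646–2655] -/
theorem muStar_le (hS : StudyBounds XS c s) (hc : 0 ≤ c) (hs : 0 ≤ s)
    (hbb2 : XS.nF ≤ CS * Lr ^ 3 * lamk ^ (1 / 4 - 10 * ε)) :
    |muStar XS| ≤ c * CS * s * Lr ^ 3 * lamk ^ (1 / 4 - 10 * ε) := by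
  calc |muStar XS| = |XS.mu| := rfl
    _ ≤ c * s * XS.nF := hS.mu_le
    _ ≤ c * s * (CS * Lr ^ 3 * lamk ^ (1 / 4 - 10 * ε)) := mul_le_mul_of_nonneg_left hbb2 (mul_nonneg hc hs)
    _ = c * CS * s * Lr ^ 3 * lamk ^ (1 / 4 - 10 * ε) := by ring

/-- **THEOREM 14, `‖E_k^*‖_{k+1,κ} ≤ 𝒪(1)L³λ_k^{1/4−10ε}`** from (bb2) and LEMMA rlem (L2653–2655).
[cite: Dimock2013, Theorem lanky (arXiv:1108.1335v2 TeX L1948–1951) and §4.8 L2646–2655] -/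
theorem EStar_le (hS : StudyBounds XS c s) (hc : 0 ≤ c)
    (hbb2 : XS.nF ≤ CS * Lr ^ 3 * lamk ^ (1 / 4 - 10 * ε)) :
    XS.nR ≤ c * CS * Lr ^ 3 * lamk ^ (1 / 4 - 10 * ε) := by
  calc XS.nR ≤ c * XS.nF := hS.R_le
    _ ≤ c * (CS * Lr ^ 3 * lamk ^ (1 / 4 - 10 * ε)) := mul_le_mul_of_nonneg_left hbb2 hc
    _ = c * CS * Lr ^ 3 * lamk ^ (1 / 4 - 10 * ε) := by ring

/-- the exponent arithmetic of L2655: `λ^{1/2+6ε} · λ^{1/4−10ε} = λ^{3/4−4ε}` (`λ > 0`). [cite: Dimock2013, §4.8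
(arXiv:1108.1335v2 TeX L2653–2655)] -/
theorem rpow_half_add (hlam : 0 < lamk) :
    lamk ^ (1 / 2 + 6 * ε) * lamk ^ (1 / 4 - 10 * ε) = lamk ^ (3 / 4 - 4 * ε) := by
  rw [← Real.rpow_add hlam]; ring_nf

/-- **THEOREM 14, `|μ_k^*| ≤ 𝒪(1)L³λ_k^{3/4−4ε}` AS PRINTED**: `muStar_le` with the small factor `s = λ_k^{1/2+6ε}`
(L2655 *"|μ_k^*| is bounded by 𝒪(1)L³λ_k^{3/4−4ε}"*). [cite: Dimock2013, Theorem lanky (arXiv:1108.1335v2 TeX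
L1948–1951) and §4.8 L2653–2655] -/
theorem muStar_le_rpow (hS : StudyBounds XS c (lamk ^ (1 / 2 + 6 * ε))) (hc : 0 ≤ c) (hlam : 0 < lamk)
    (hbb2 : XS.nF ≤ CS * Lr ^ 3 * lamk ^ (1 / 4 - 10 * ε)) :
    |muStar XS| ≤ c * CS * Lr ^ 3 * lamk ^ (3 / 4 - 4 * ε) := by
  have h := muStar_le hS hc (Real.rpow_nonneg hlam.le _) hbb2
  calc |muStar XS| ≤ c * CS * lamk ^ (1 / 2 + 6 * ε) * Lr ^ 3 * lamk ^ (1 / 4 - 10 * ε) := h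
    _ = c * CS * Lr ^ 3 * (lamk ^ (1 / 2 + 6 * ε) * lamk ^ (1 / 4 - 10 * ε)) := by ring
    _ = c * CS * Lr ^ 3 * lamk ^ (3 / 4 - 4 * ε) := by rw [rpow_half_add hlam]

/-- **THE NORM OF `E_{k+1}`**: if the norm is subadditive on the two remainders (`‖𝓛₃E_k + E_k^*‖ ≤ ‖𝓛₃E_k‖ + ‖E_k^*‖`,
an input — the module does not type `‖·‖_{k+1,κ}`), then `‖E_{k+1}‖_{k+1,κ} ≤ c·c_B L^{−ε}‖E_k‖ + cC L³λ_k^{1/4−10ε}` —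
the shape consumed by the flow (§5, (jelly)). [cite: Dimock2013, Theorem lanky eq. (recursive) and bounds
(arXiv:1108.1335v2 TeX L1932–1951)] -/
theorem ENext_norm_le {nNext : ℝ} (hsub : nNext ≤ XB.nR + XS.nR) (hSB : StudyBounds XB c s)
    (hSS : StudyBounds XS c s) (hc : 0 ≤ c) (hbb1 : XB.nF ≤ cB * Lr ^ (-ε) * nE)
    (hbb2 : XS.nF ≤ CS * Lr ^ 3 * lamk ^ (1 / 4 - 10 * ε)) :
    nNext ≤ c * cB * Lr ^ (-ε) * nE + c * CS * Lr ^ 3 * lamk ^ (1 / 4 - 10 * ε) :=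
  hsub.trans (add_le_add (L3E_le hSB hc hbb1) (EStar_le hSS hc hbb2))

end bounds

/-! ## §4 The `κ`-arithmetic of L2576–2577 and the pointwise-to-norm step (bb2) -/

/-- *"We need L(κ − 5κ₀ − 5) ≥ κ or equivalently κ ≥ 5L(L−1)^{−1}(κ₀+1)"* (L2576), for `L > 1`.
[cite: Dimock2013, §4.7 (arXiv:1108.1335v2 TeX L2576–2577)] -/
theorem kappa_condition_iff {Lr κ κ₀ : ℝ} (hL : 1 < Lr) :
    κ ≤ Lr * (κ - 5 * κ₀ - 5) ↔ 5 * Lr * (Lr - 1)⁻¹ * (κ₀ + 1) ≤ κ := by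
  have hL1 : 0 < Lr - 1 := by linarith
  rw [show 5 * Lr * (Lr - 1)⁻¹ * (κ₀ + 1) = 5 * Lr * (κ₀ + 1) / (Lr - 1) by ring, div_le_iff₀ hL1]
  constructor <;> intro h <;> nlinarith

/-- *"Since L ≥ 2 it suffices that κ ≥ 10(κ₀+1) which we assume"* (L2577): for `L ≥ 2`, `κ₀ + 1 ≥ 0` and `κ ≥ 10(κ₀+1)`
indeed `L(κ − 5κ₀ − 5) ≥ κ`. [cite: Dimock2013, §4.7 (arXiv:1108.1335v2 TeX L2576–2577)] -/
theorem kappa_condition_of_ten {Lr κ κ₀ : ℝ} (hL : 2 ≤ Lr) (hκ₀ : 0 ≤ κ₀ + 1) (hκ : 10 * (κ₀ + 1) ≤ κ) :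
    κ ≤ Lr * (κ - 5 * κ₀ - 5) := by
  nlinarith

/-- With `L(κ − 5κ₀ − 5) ≥ κ` the decay rate of (osprey) after reblocking dominates `κ`: `e^{−L(κ−5κ₀−5)d} ≤ e^{−κd}` for
`d ≥ 0`. [cite: Dimock2013, §4.7 (arXiv:1108.1335v2 TeX L2570–2582)] -/
theorem exp_rate_le {Lr κ κ₀ d : ℝ} (h : κ ≤ Lr * (κ - 5 * κ₀ - 5)) (hd : 0 ≤ d) :
    exp (-(Lr * (κ - 5 * κ₀ - 5)) * d) ≤ exp (-κ * d) := by
  rw [Real.exp_le_exp]; nlinarith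

/-- THE WEIGHTED SUPREMUM `sup_X |G(X)| e^{κ d(X)}` over a finite nonempty family of polymers — the shape of the norm
`‖·‖_{k+1,κ}` of §3.3 (L1333 *"‖E‖_{k,κ} = sup_X ‖E(X)‖_k e^{κ d_M(X)}"*) with the `φ`-supremum already taken (`G X` a
real). [cite: Dimock2013, §3.3 (arXiv:1108.1335v2 TeX L1332–1334)] -/
def weightedSup {P : Type*} (D : Finset P) (hD : D.Nonempty) (d : P → ℝ) (κ : ℝ) (G : P → ℝ) : ℝ :=
  D.sup' hD fun X => |G X| * exp (κ * d X)

/-- **(bb2), the pointwise-to-norm step**: *"|E^#_{k,L^{−1}}(X, φ)| ≤ 𝒪(1)L³λ_k^{1/4−10ε} e^{−L(κ−5κ₀−5)d_{LM}(X)} … Then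
‖E^#_{k,L^{−1}}‖_{k+1,κ} ≤ 𝒪(1)L³λ_k^{1/4−10ε}"* (L2572–2582): a pointwise bound `|G(X)| ≤ A e^{−κ′ d(X)}` with `κ ≤ κ′`,
`d ≥ 0` gives `sup_X |G(X)|e^{κ d(X)} ≤ A`. [cite: Dimock2013, §4.7 eq. (bb2) (arXiv:1108.1335v2 TeX L2570–2582)] -/
theorem weightedSup_le_of_pointwise {P : Type*} {D : Finset P} (hD : D.Nonempty) {d : P → ℝ} {κ κ' A : ℝ}
    {G : P → ℝ} (hd : ∀ X ∈ D, 0 ≤ d X) (hκ : κ ≤ κ') (hG : ∀ X ∈ D, |G X| ≤ A * exp (-κ' * d X)) :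
    weightedSup D hD d κ G ≤ A := by
  unfold weightedSup
  refine Finset.sup'_le hD _ fun X hX => ?_
  have hA : 0 ≤ A := by
    have h0 := (abs_nonneg (G X)).trans (hG X hX)
    by_contra hneg
    have hneg' : A < 0 := lt_of_not_ge hneg
    have : A * exp (-κ' * d X) < 0 := mul_neg_of_neg_of_pos hneg' (Real.exp_pos _)
    linarith
  calc |G X| * exp (κ * d X) ≤ A * exp (-κ' * d X) * exp (κ * d X) :=
        mul_le_mul_of_nonneg_right (hG X hX) (Real.exp_pos _).le
    _ = A * exp ((κ - κ') * d X) := by rw [mul_assoc, ← Real.exp_add]; ring_nf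
    _ ≤ A * 1 := by
        refine mul_le_mul_of_nonneg_left ?_ hA
        rw [Real.exp_le_one_iff]
        exact mul_nonpos_of_nonpos_of_nonneg (by linarith) (hd X hX)
    _ = A := mul_one A

/-- (bb2) with the printed rates: `κ ≥ 10(κ₀+1)`, `L ≥ 2`, `κ₀ ≥ −1` and the pointwise bound of (osprey)-after-reblocking
with rate `L(κ − 5κ₀ − 5)` give the norm bound `𝒪(1)L³λ_k^{1/4−10ε}`. [cite: Dimock2013, §4.7 eq. (bb2)
(arXiv:1108.1335v2 TeX L2570–2582)] -/
theorem bb2_of_osprey {P : Type*} {D : Finset P} (hD : D.Nonempty) {d : P → ℝ} {κ κ₀ Lr C lamk ε : ℝ}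
    {G : P → ℝ} (hd : ∀ X ∈ D, 0 ≤ d X) (hL : 2 ≤ Lr) (hκ₀ : 0 ≤ κ₀ + 1) (hκ : 10 * (κ₀ + 1) ≤ κ)
    (hG : ∀ X ∈ D, |G X| ≤ C * Lr ^ 3 * lamk ^ (1 / 4 - 10 * ε) * exp (-(Lr * (κ - 5 * κ₀ - 5)) * d X)) :
    weightedSup D hD d κ G ≤ C * Lr ^ 3 * lamk ^ (1 / 4 - 10 * ε) :=
  weightedSup_le_of_pointwise hD hd (kappa_condition_of_ten hL hκ₀ hκ) hG

/-! ## §5 The scaling of the potential (L2551–2555) -/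

/-- THE POTENTIAL `V_k(φ) = ε_kVol + ½μ_k‖φ‖² + ¼λ_k∫φ⁴` (L2551, with §4.1's `V_k`). [cite: Dimock2013, §4.7
(arXiv:1108.1335v2 TeX L2551–2555)] -/
def potential (epsk muk lamk Vol nsqφ quartφ : ℝ) : ℝ :=
  epsk * Vol + (1 / 2) * muk * nsqφ + (1 / 4) * lamk * quartφ

/-- **`V_k(φ_{k+1,L}) = L³ε_kVol(𝕋_{M+N−k−1}) + ½L²μ_k‖φ_{k+1}‖² + ¼Lλ_k∫φ_{k+1}⁴`** (L2552–2555) from the three scaling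
rules `Vol(𝕋_{M+N−k}) = L³Vol(𝕋_{M+N−k−1})`, `‖φ_{k+1,L}‖² = L²‖φ_{k+1}‖²`, `∫φ_{k+1,L}⁴ = L∫φ_{k+1}⁴` (hypotheses: the
canonical scaling `φ_L(x) = L^{−1/2}φ(x/L)` of §2.3, kernel elsewhere); note `¼Lλ_k = ¼λ_{k+1}`. [cite: Dimock2013, §4.7
(arXiv:1108.1335v2 TeX L2547–2555)] -/
theorem V_scaled {epsk muk lamk Lr Volk Volk1 nsqL nsq1 quartL quart1 : ℝ} (hVol : Volk = Lr ^ 3 * Volk1)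
    (hnsq : nsqL = Lr ^ 2 * nsq1) (hquart : quartL = Lr * quart1) :
    potential epsk muk lamk Volk nsqL quartL =
      Lr ^ 3 * epsk * Volk1 + (1 / 2) * (Lr ^ 2 * muk) * nsq1 + (1 / 4) * lamNext Lr lamk * quart1 := by
  simp only [potential, hVol, hnsq, hquart, lamNext]; ring

/-- Non-vacuity of the shapes: the zero functional with the trivial extraction satisfies `StudyBounds` with `c = s = 0`.
[folklore] -/
example : StudyBounds (V := (1 : ℝ)) (nsq := fun _ : Unit => (0 : ℝ))
    { F := fun _ => 0, nF := 0, eps := 0, mu := 0, R := fun _ => 0, nR := 0, nF_nonneg := le_rfl,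
      eq := fun _ => by simp } 0 0 :=
  ⟨by simp, by simp, by simp⟩

end Literature.MathematicalPhysics.QuantumFieldTheory.Dimock2011to13.SmallFieldStepAssembly

end
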